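import Summits.BirchSwinnertonDyer.Rank1Residual.X1.LayerAlgebra
import Summits.BirchSwinnertonDyer.Rank1Residual.X1.CharIdealRestrictScalars
import Summits.BirchSwinnertonDyer.Rank1Residual.X1.GeneratorBoundOrd
import Summits.BirchSwinnertonDyer.Rank1Residual.X1.GeneratorCountLayerTransport
import Literature.NumberTheory.EllipticCurves.CyclotomicIwasawaMainTheoremIrreducibleProofs
import HarnessLib

/-!
# LEMMA M AT LAYER `n`: `p^B ≤ #(X/(p, ω_n)X)` and no finite submodule ⇒ `N_n(char X) ∈ 𝔪^B`

B2B cell `bsd-rank1-residual`, unit `eisenstein-p1` GEN 18, FILE 15 (X1R0-GAPMAP §21.1 LEMMA M,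
§26.4 (M3), §27; `V76-LOCAL-TERM-PLAN.md` §3–§3.1 = (M3-n), V87). HONEST FRAMING: research route;
THEOREMS ONLY (no `def`, no named fact); nothing booked; no label moved. This is the statement
the seven `M:paper` classes of the census use at layer `1` ("`3μ + mord₁(D) ≥ B₁`").

For a finitely generated torsion `Λ = ℤ_p⟦T⟧`-module `X` WITHOUT non-zero finite submodules, with
`char_Λ X = (f)`, and the layer-`n` count `p^B ≤ #(X/I_n X)`, `I_n = (p, ω_n)`,
`ω_n = (1+T)^{pⁿ} − 1`:

  **`N_n(f) ∈ 𝔪^B`** (`layerNorm_mem_maximalIdeal_pow`), where `N_n = layerNorm p n : Λ →* Λ` is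
  the norm of the finite free extension `Λ ⊃ Λ_n = ℤ_p⟦ω_n⟧` written in the variable of
  `Λ_n ≅ ℤ_p⟦S⟧` (FILE 13); hence `p^{B−i} ∣ N_n(f)_i` and `B ≤ v_p(N_n(f)_i) + i` for all `i`
  (`ord_𝔪 N_n(f) ≥ B`, the census column `mord_n`).

Proof (§2): a square minimal-free presentation `0 → Λ^g —P→ Λ^g → X → 0` over `Λ` (FILE 11
`free_ker`, `pd_Λ X ≤ 1`); its LAYER TWIST `C = Λ^g / P(Λ^g)` with `Λ^g` regarded over `Λ_n`
(`Fin g → Layer p n`, restriction of scalars) is an honest finitely generated torsion `Λ_n`-module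
with `char_{Λ_n} C = (N_n(det P)) = (N_n(f))` (FILE 14: `det` of the restriction of scalars is the
norm of `det`; FILE 12: `char` of a square cokernel); the map `v ↦ π(v)` is a `layerHom`-SEMILINEAR
bijection `C → X`, along which "no finite submodule" and the count `#(C/𝔪C) = #(X/I_n X)`
transport (FILE 14 §3, using `Λ = ⊕_{i<pⁿ} Λ_n T^i` from FILE 13 and `layerHom(𝔪)Λ = I_n`, §1);
LEMMA M at layer `0` (FILE 11 `charIdeal_le_maximalIdeal_pow`) applied to `C` gives
`char C ⊆ 𝔪^B`. §3: coefficient forms; §4: the Selmer reading.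

## Sources
* R. Greenberg, LNM 1716 (1999), p. 137 (the generator count), §1 p. 60 (`X/(p,ω_n)X` dual to
  `Sel[p]^{Γ_n}`). [GreenbergLNM1716]
* L. Washington, GTM 83, §13.2 (`Λ` over `ℤ_p⟦ω_n⟧`; Lemma 13.15 ff.). [Washington1997]
* C. Skinner, E. Urban, Invent. Math. 195 (2014), §3.1.6 (`Fitt₀` and `char`) — tree.
-/

noncomputable section

namespace Summit.BirchSwinnertonDyer.Rank1Residual.X1.GeneratorBoundOrdLayer

open PowerSeries IsLocalRing Literature.NumberTheory.EllipticCurves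
  Literature.RingTheory.FittingIdeal Summit.BirchSwinnertonDyer.Rank1Residual.X1.LayerAlgebra

open scoped Matrix

variable {p : ℕ} [hp : Fact p.Prime] {n : ℕ}

/-! ## §1. `𝔪 = (p, T)` and `layerHom(𝔪)·Λ = I_n = (p, ω_n)`; `Λ = ∑ Λ_n T^i` -/

variable (p) in
/-- `𝔪_Λ = (p, T)`. [folklore] -/
theorem maximalIdeal_eq_span_C_p_X :
    maximalIdeal (IwasawaAlgebra p) =
      Ideal.span {(C (p : ℤ_[p]) : IwasawaAlgebra p), (X : IwasawaAlgebra p)} := by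
  refine le_antisymm GeneratorCountLayer.maximalIdeal_le_span_C_p_X (Ideal.span_le.2 ?_)
  rintro z hz
  simp only [Set.mem_insert_iff, Set.mem_singleton_iff] at hz
  rw [SetLike.mem_coe, mem_maximalIdeal, mem_nonunits_iff]
  intro hu
  have h := hu.map (constantCoeff (R := ℤ_[p]))
  rcases hz with rfl | rfl
  · rw [constantCoeff_C] at h
    exact PadicInt.irreducible_p.not_isUnit h
  · rw [constantCoeff_X] at h
    exact not_isUnit_zero h

variable (p n) in
/-- **`layerHom(𝔪)·Λ = I_n = (p, ω_n)`**: the extension of `𝔪_{Λ_n} = (p, S)` along `S ↦ ω_n`.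
[cite: Washington1997, §13.2] -/
theorem map_layerHom_maximalIdeal :
    (maximalIdeal (IwasawaAlgebra p)).map (layerHom p n) =
      Ideal.span {(C (p : ℤ_[p]) : IwasawaAlgebra p), (1 + X : IwasawaAlgebra p) ^ p ^ n - 1} := by
  rw [maximalIdeal_eq_span_C_p_X p, Ideal.map_span, Set.image_pair, layerHom_C, layerHom_X]

variable (n) in
/-- `Λ = ∑_{i<pⁿ} layerHom(Λ)·T^i` (FILE 13 `coord`). [cite: Washington1997, §13.2] -/
theorem exists_eq_sum_layerHom_mul_X_pow (x : IwasawaAlgebra p) :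
    ∃ a : Fin (p ^ n) → IwasawaAlgebra p, x = ∑ i, layerHom p n (a i) * (X : IwasawaAlgebra p) ^ (i : ℕ) :=
  ⟨coord p n x, (sum_layerHom_coord_mul_X_pow x).symm⟩

/-! ## §2. The layer twist of a square presentation and LEMMA M at layer `n` -/

section Twist

variable {M : Type*} [AddCommGroup M] [Module (IwasawaAlgebra p) M]

/-- `det` of the twisted relation map `v ↦ (P.map of)ᵀ v` is `of(det P)`. [folklore] -/
theorem det_toLin'_transpose_map {g : ℕ} (P : Matrix (Fin g) (Fin g) (IwasawaAlgebra p)) :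
    LinearMap.det (Matrix.toLin' (P.map (Layer.of p n))ᵀ) = Layer.of p n P.det := by
  rw [LinearMap.det_toLin', Matrix.det_transpose]
  exact ((Layer.of p n).toRingHom.map_det P).symm

/-- The range of the twisted relation map, restricted to `Λ`, is `of(span of the rows of P)`.
[folklore] -/
theorem mem_range_restrictScalars_toLin'_iff {g : ℕ} (P : Matrix (Fin g) (Fin g) (IwasawaAlgebra p))
    (v : Fin g → Layer p n) :
    v ∈ LinearMap.range ((Matrix.toLin' (P.map (Layer.of p n))ᵀ).restrictScalars (IwasawaAlgebra p)) ↔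
      (fun l => (Layer.of p n).symm (v l)) ∈ Submodule.span (IwasawaAlgebra p) (Set.range P) := by
  have key : ∀ w : Fin g → Layer p n, (fun l => (Layer.of p n).symm
      ((Matrix.toLin' (P.map (Layer.of p n))ᵀ) w l)) = ∑ t, (Layer.of p n).symm (w t) • P t := by
    intro w
    funext l
    rw [Matrix.toLin'_apply, Finset.sum_apply]
    simp only [Matrix.mulVec, dotProduct, Matrix.transpose_apply, Matrix.map_apply, Pi.smul_apply,
      smul_eq_mul, map_sum, map_mul, RingEquiv.symm_apply_apply]
    exact Finset.sum_congr rfl fun t _ => mul_comm _ _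
  constructor
  · rintro ⟨w, rfl⟩
    rw [LinearMap.coe_restrictScalars, key]
    exact Submodule.sum_mem _ fun t _ => Submodule.smul_mem _ _ (Submodule.subset_span ⟨t, rfl⟩)
  · intro hv
    obtain ⟨c, hc⟩ := (Submodule.mem_span_range_iff_exists_fun (IwasawaAlgebra p)).1 hv
    refine ⟨fun t => Layer.of p n (c t), ?_⟩
    have h := key fun t => Layer.of p n (c t)
    simp only [RingEquiv.symm_apply_apply] at h
    rw [hc] at h
    ext l
    have := congr_fun h l
    rw [LinearMap.coe_restrictScalars]
    exact (Layer.of p n).symm.injective this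

/-- **LEMMA M AT LAYER `n`.** For a finitely generated torsion `Λ`-module `X` without non-zero
finite submodules, `char_Λ X = (f)` and `p^B ≤ #(X/(p, ω_n)X)` imply `N_n(f) ∈ 𝔪^B`, where
`N_n = layerNorm p n` is the norm of `Λ` over `Λ_n = ℤ_p⟦ω_n⟧` (in the variable of `Λ_n ≅ Λ`).
[cite: GreenbergLNM1716, p. 137] [cite: Washington1997, §13.2] -/
theorem layerNorm_mem_maximalIdeal_pow [Module.Finite (IwasawaAlgebra p) M]
    (hM : Module.IsTorsion (IwasawaAlgebra p) M)
    (hnf : ∀ N : Submodule (IwasawaAlgebra p) M, Finite N → N = ⊥) {B : ℕ}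
    (hB : p ^ B ≤ Nat.card (M ⧸ Ideal.span {(C (p : ℤ_[p]) : IwasawaAlgebra p),
        (1 + X : IwasawaAlgebra p) ^ p ^ n - 1} • (⊤ : Submodule (IwasawaAlgebra p) M)))
    {f : IwasawaAlgebra p} (hchar : Module.charIdeal (IwasawaAlgebra p) M = Ideal.span {f}) :
    layerNorm p n f ∈ maximalIdeal (IwasawaAlgebra p) ^ B := by
  classical
  -- (1) a square presentation over `Λ`
  obtain ⟨g, x, hx⟩ := Module.Finite.exists_fin (R := IwasawaAlgebra p) (M := M)
  let π : (Fin g → IwasawaAlgebra p) →ₗ[IwasawaAlgebra p] M := Fintype.linearCombination _ x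
  have hπ : ∀ c, π c = ∑ i, c i • x i := fun c => Fintype.linearCombination_apply _ _ c
  have hsurj : Function.Surjective π := by
    rw [← LinearMap.range_eq_top, eq_top_iff, ← hx, Submodule.span_le]
    rintro _ ⟨i, rfl⟩
    refine ⟨Pi.single i 1, ?_⟩
    rw [hπ, Finset.sum_eq_single i (fun j _ hj => by rw [Pi.single_eq_of_ne hj, zero_smul])
      (fun hi => absurd (Finset.mem_univ i) hi), Pi.single_eq_same, one_smul]
  haveI := GeneratorBoundOrd.free_ker π hnf
  let bK : Module.Basis (Fin g) (IwasawaAlgebra p) (LinearMap.ker π) :=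
    Module.finBasisOfFinrankEq _ _ (GeneratorBoundOrd.finrank_ker_eq π hsurj hM)
  let P : Matrix (Fin g) (Fin g) (IwasawaAlgebra p) :=
    Matrix.of fun t l => ((bK t : LinearMap.ker π) : Fin g → IwasawaAlgebra p) l
  have hK : LinearMap.ker π = Submodule.span (IwasawaAlgebra p) (Set.range P) := by
    have e : Set.range P = (LinearMap.ker π).subtype '' Set.range bK := by
      rw [← Set.range_comp]; rfl
    rw [e, Submodule.span_image, bK.span_eq, Submodule.map_subtype_top]
  have hPrel : ∀ t, ∑ l, P t l • x l = 0 := fun t => by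
    have := (bK t).2
    rw [LinearMap.mem_ker, hπ] at this
    simpa [P] using this
  have hgen : ∀ ρ : Fin g → IwasawaAlgebra p, ∑ l, ρ l • x l = 0 →
      ρ ∈ Submodule.span (IwasawaAlgebra p) (Set.range P) := fun ρ hρ => by
    rw [← hK, LinearMap.mem_ker, hπ]; exact hρ
  -- `char X = Fitt₀ X = (det P)`, so `f ~ det P` and `det P ≠ 0`
  have hfit := Module.fittingIdeal_zero_eq_span_det_of_square_presentation x hx P hPrel hgen
  have hcharP : Module.charIdeal (IwasawaAlgebra p) M = Ideal.span {P.det} := by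
    rw [GeneratorBoundOrd.charIdeal_eq_fittingIdeal_zero hM hnf, hfit]
  have hassoc : Associated f P.det := by
    rw [← Ideal.span_singleton_eq_span_singleton, ← hchar, hcharP]
  have hdet : P.det ≠ 0 := by
    intro h0
    apply Module.charIdeal_ne_bot (IwasawaAlgebra p) M
    rw [hcharP, h0, Ideal.span_singleton_eq_bot]
  -- (2) the layer twist `C`
  let e := Matrix.toLin' (P.map (Layer.of p n))ᵀ
  have hdete : LinearMap.det e = Layer.of p n P.det := det_toLin'_transpose_map P
  have hdete0 : LinearMap.det e ≠ 0 := by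
    rw [hdete]; exact (map_ne_zero_iff _ (Layer.of p n).injective).2 hdet
  let e' := e.restrictScalars (IwasawaAlgebra p)
  -- the semilinear evaluation `v ↦ π (of⁻¹ ∘ v)`
  let ψ₀ : (Fin g → Layer p n) →ₛₗ[layerHom p n] M :=
    { toFun := fun v => π fun l => (Layer.of p n).symm (v l)
      map_add' := fun v w => by
        rw [← map_add]
        rfl
      map_smul' := fun a v => by
        rw [← map_smul]
        congr 1 }
  have hψ₀ : ∀ v, ψ₀ v = π (fun l => (Layer.of p n).symm (v l)) := fun v => rfl
  have hker : LinearMap.range e' ≤ LinearMap.ker ψ₀ := fun v hv => by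
    rw [LinearMap.mem_ker, hψ₀, ← LinearMap.mem_ker, hK]
    exact (mem_range_restrictScalars_toLin'_iff P v).1 hv
  let ψ := (LinearMap.range e').liftQ ψ₀ hker
  have hψinj : Function.Injective ψ := by
    rw [← LinearMap.ker_eq_bot]
    refine Submodule.ker_liftQ_eq_bot _ _ _ fun v hv => ?_
    rw [LinearMap.mem_ker, hψ₀, ← LinearMap.mem_ker, hK] at hv
    exact (mem_range_restrictScalars_toLin'_iff P v).2 hv
  have hψsurj : Function.Surjective ψ := fun m => by
    obtain ⟨u, rfl⟩ := hsurj m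
    exact ⟨Submodule.Quotient.mk fun l => Layer.of p n (u l), by
      rw [Submodule.liftQ_apply, hψ₀]; rfl⟩
  -- (3) the hypotheses of LEMMA M for `C`
  have hCtors : Module.IsTorsion (IwasawaAlgebra p) ((Fin g → Layer p n) ⧸ LinearMap.range e') :=
    CharIdealRestrictScalars.isTorsion_quotient_range_restrictScalars e hdete0
  have hCnf : ∀ N : Submodule (IwasawaAlgebra p) ((Fin g → Layer p n) ⧸ LinearMap.range e'),
      Finite N → N = ⊥ :=
    CharIdealRestrictScalars.eq_bot_of_finite_of_semilinear (layerHom p n) ψ hψinj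
      (fun i : Fin (p ^ n) => (X : IwasawaAlgebra p) ^ (i : ℕ)) (exists_eq_sum_layerHom_mul_X_pow n)
      hnf
  have hCcount : p ^ B ≤ Nat.card (((Fin g → Layer p n) ⧸ LinearMap.range e') ⧸
      maximalIdeal (IwasawaAlgebra p) • (⊤ : Submodule (IwasawaAlgebra p)
        ((Fin g → Layer p n) ⧸ LinearMap.range e'))) := by
    rw [CharIdealRestrictScalars.natCard_quotient_eq_of_semilinear (layerHom p n) ψ
      ⟨hψinj, hψsurj⟩, map_layerHom_maximalIdeal]
    exact hB
  -- (4) LEMMA M at layer 0 for `C`, and `char C = (N_n(det P))`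
  have hle := GeneratorBoundOrd.charIdeal_le_maximalIdeal_pow hCtors hCnf hCcount
  rw [CharIdealRestrictScalars.charIdeal_quotient_range_restrictScalars e hdete0, hdete,
    Ideal.span_singleton_le_iff_mem] at hle
  obtain ⟨u, hu⟩ := (associated_layerNorm p n hassoc).symm
  rw [← hu]
  exact Ideal.mul_mem_right _ _ hle

/-! ## §3. Coefficient forms: `ord_𝔪 N_n(f) ≥ B` -/

/-- **LEMMA M at layer `n`, coefficient form:** `p^{B−i} ∣ N_n(f)_i` for every `i`.
[cite: GreenbergLNM1716, p. 137] -/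
theorem pow_dvd_coeff_layerNorm [Module.Finite (IwasawaAlgebra p) M]
    (hM : Module.IsTorsion (IwasawaAlgebra p) M)
    (hnf : ∀ N : Submodule (IwasawaAlgebra p) M, Finite N → N = ⊥) {B : ℕ}
    (hB : p ^ B ≤ Nat.card (M ⧸ Ideal.span {(C (p : ℤ_[p]) : IwasawaAlgebra p),
        (1 + X : IwasawaAlgebra p) ^ p ^ n - 1} • (⊤ : Submodule (IwasawaAlgebra p) M)))
    {f : IwasawaAlgebra p} (hchar : Module.charIdeal (IwasawaAlgebra p) M = Ideal.span {f})
    (i : ℕ) : (p : ℤ_[p]) ^ (B - i) ∣ coeff i (layerNorm p n f) :=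
  GeneratorBoundFitting.pow_dvd_coeff_of_mem_maximalIdeal_pow
    (layerNorm_mem_maximalIdeal_pow hM hnf hB hchar) i

/-- **LEMMA M at layer `n`, census form:** `B ≤ v_p(N_n(f)_i) + i` for every non-zero
coefficient `N_n(f)_i` (the census's `mord_n ≥ B_n`). [cite: GreenbergLNM1716, p. 137] -/
theorem le_valuation_coeff_layerNorm_add [Module.Finite (IwasawaAlgebra p) M]
    (hM : Module.IsTorsion (IwasawaAlgebra p) M)
    (hnf : ∀ N : Submodule (IwasawaAlgebra p) M, Finite N → N = ⊥) {B : ℕ}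
    (hB : p ^ B ≤ Nat.card (M ⧸ Ideal.span {(C (p : ℤ_[p]) : IwasawaAlgebra p),
        (1 + X : IwasawaAlgebra p) ^ p ^ n - 1} • (⊤ : Submodule (IwasawaAlgebra p) M)))
    {f : IwasawaAlgebra p} (hchar : Module.charIdeal (IwasawaAlgebra p) M = Ideal.span {f})
    {i : ℕ} (hi : coeff i (layerNorm p n f) ≠ 0) :
    B ≤ (coeff i (layerNorm p n f)).valuation + i :=
  GeneratorBoundFitting.le_valuation_coeff_add_of_mem_maximalIdeal_pow
    (layerNorm_mem_maximalIdeal_pow hM hnf hB hchar) i hi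

/-- `N_n(p^μ · D · u) = p^{μ pⁿ} · N_n(D) · N_n(u)`: the `μ`-part contributes `pⁿμ` to `ord_𝔪`
(the census's `pⁿ μ + mord_n(D) ≥ B_n`). [folklore] -/
theorem layerNorm_C_pow_mul (μ : ℕ) (D : IwasawaAlgebra p) :
    layerNorm p n (C ((p : ℤ_[p]) ^ μ) * D) = C ((p : ℤ_[p]) ^ (μ * p ^ n)) * layerNorm p n D := by
  rw [map_mul, layerNorm_C, ← pow_mul]

end Twist

/-! ## §4. Route M's reading for `X = X(E/K_∞)` -/

section Selmer

open WeierstrassCurve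

/-- **Route M at layer `n` in the kernel:** for ANY torsion Pontryagin-dual Selmer datum `D` over
a `ℤ_p`-extension whose `X = D.X` has no non-zero finite submodule, a layer-`n` count
`p^B ≤ #(X/(p, ω_n)X)` (FILES 4–9: from `Γ^{pⁿ}`-fixed `p`-torsion Selmer classes over the layer
`K_n`) gives `N_n(f_E) ∈ 𝔪^B` for every characteristic power series `f_E` of `X`, i.e.
`B ≤ min_i (v_p(N_n(f_E)_i) + i)`. [cite: GreenbergLNM1716, p. 137 (the count; shape only)] -/
theorem layerNorm_charIdeal_mem_of_count {K : Type} [Field K] [NumberField K]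
    {W : WeierstrassCurve K} {κ : ZpExtension K p} {γ : Field.absoluteGaloisGroup K}
    (D : W.SelmerDualData κ γ) [Module.Finite (IwasawaAlgebra p) D.X] (hD : D.IsTorsion)
    (hnf : ∀ N : Submodule (IwasawaAlgebra p) D.X, Finite N → N = ⊥) {B : ℕ}
    (hB : p ^ B ≤ Nat.card (D.X ⧸ Ideal.span {(C (p : ℤ_[p]) : IwasawaAlgebra p),
        (1 + X : IwasawaAlgebra p) ^ p ^ n - 1} • (⊤ : Submodule (IwasawaAlgebra p) D.X)))
    {f : IwasawaAlgebra p} (hchar : Module.charIdeal (IwasawaAlgebra p) D.X = Ideal.span {f}) :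
    layerNorm p n f ∈ maximalIdeal (IwasawaAlgebra p) ^ B ∧
      ∀ i, (p : ℤ_[p]) ^ (B - i) ∣ coeff i (layerNorm p n f) :=
  ⟨layerNorm_mem_maximalIdeal_pow hD hnf hB hchar, pow_dvd_coeff_layerNorm hD hnf hB hchar⟩

/-- Route M at layer `n` over `ℚ` through the typed input `NoFiniteSubmoduleAt p W`
(Greenberg Prop. 4.14/4.15) for the cyclotomic tower. [cite: GreenbergLNM1716, p. 137 (the count; shape only)] -/
theorem layerNorm_charIdeal_mem_of_noFiniteSubmoduleAt {W : WeierstrassCurve ℚ} [W.IsElliptic]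
    [W.IsGloballyMinimal] (hnf : Additive.NoFiniteSubmoduleAt p W)
    (κ : ZpExtension ℚ p) (γ : Field.absoluteGaloisGroup ℚ) (hκ : κ.IsCyclotomic)
    (hγ : κ.IsTopGenerator γ) (hγv : IsCyclotomicVariable p γ) (D : W.SelmerDualData κ γ)
    [Module.Finite (IwasawaAlgebra p) D.X] (hD : D.IsTorsion) {B : ℕ}
    (hB : p ^ B ≤ Nat.card (D.X ⧸ Ideal.span {(C (p : ℤ_[p]) : IwasawaAlgebra p),
        (1 + X : IwasawaAlgebra p) ^ p ^ n - 1} • (⊤ : Submodule (IwasawaAlgebra p) D.X)))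
    {f : IwasawaAlgebra p} (hchar : Module.charIdeal (IwasawaAlgebra p) D.X = Ideal.span {f}) :
    layerNorm p n f ∈ maximalIdeal (IwasawaAlgebra p) ^ B :=
  layerNorm_mem_maximalIdeal_pow hD (hnf hκ hγ hγv D hD) hB hchar

end Selmer

/-! ## §5. Route T's layer-`n` Tamagawa count feeding LEMMA M at layer `n`: `t_n ≤ ord_𝔪 N_n(f_E)` -/

section Tamagawa

open scoped Classical

open Function Field NumberField IsDedekindDomain Literature.NumberTheory.GaloisRepresentations
  Literature.NumberTheory.GaloisCohomology Summit.BirchSwinnertonDyer.Rank1Residual.Additive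
  Summit.BirchSwinnertonDyer.Rank1Residual.Additive.ZpTower
open Literature.NumberTheory.GaloisRepresentations.DiscreteGaloisModule (unramifiedSubgroup)

/-- **Route M at layer `n`, Tamagawa part of the count (FILE 6) + LEMMA M at layer `n`:** over the
layer `K_n` of a `ℤ_p`-extension `κ` of `K` with restricted tower `κ_n` — `p` odd, `E(K)[p] = 0`,
`κ` cyclotomic, a Poitou–Tate family and the local Euler–Poincaré formula over `K_n` (hypotheses),
`T₀` places `w ∤ p` of `K_n` with Tamagawa witnesses — every torsion dual datum `D` of
`Sel_{p^∞}(E/K_∞)` without finite submodules and `char D.X = (f)` has **`N_n(f) ∈ 𝔪^{#T₀}`**, i.e.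
`t_n ≤ min_i (v_p(N_n(f)_i) + i)`. (The local term `a` at the prime over `p` — FILE 9's `𝓛`,
`hidx`, `hloc` — is NOT included here.) [cite: GreenbergLNM1716, §5 pp. 114–118, p. 137] -/
theorem layerNorm_mem_of_tamagawaWitnesses_layer {K : Type} [Field K] [NumberField K]
    {W : WeierstrassCurve K} [W.IsElliptic] (κ : ZpExtension K p) (n : ℕ)
    (κn : ZpExtension (κ.layer n) p)
    (hκn : ∀ σ : Field.absoluteGaloisGroup (κ.layer n),
      (κn σ).toAdd * (p : ℤ_[p]) ^ n = (κ (resGal (K := K) (κ.layer n) σ)).toAdd)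
    {γ : Field.absoluteGaloisGroup K} (D : W.SelmerDualData κ γ)
    [Module.Finite (IwasawaAlgebra p) D.X] [NumberField (κ.layer n)] (hodd : p ≠ 2)
    (hX : D.IsTorsion) (hnf : ∀ N : Submodule (IwasawaAlgebra p) D.X, Finite N → N = ⊥)
    (hK : ∀ P : W.toAffine.Point, p • P = 0 → P = 0) (hκ : κ.IsCyclotomic)
    (inv : LocalInvariants (κ.layer n) p) (hperf : inv.IsPerfect) (hsum : inv.SumLocalTermEqZero)
    (hcompl : inv.SelmerComplement)
    (hEP : ∀ w : HeightOneSpectrum (𝓞 (κ.layer n)),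
      localEulerPoincareCharacteristic (w.adicCompletion (κ.layer n)))
    (T₀ : Finset (HeightOneSpectrum (𝓞 (κ.layer n))))
    (hT₀p : ∀ w ∈ T₀, ((p : ℕ) : 𝓞 (κ.layer n)) ∉ w.asIdeal)
    (hwit : ∀ w ∈ T₀, ∃ u ∈ unramifiedSubgroup
        (((W.baseChange (κ.layer n)).torsionGaloisModule (p : ℤ)).restrictField
          (w.adicCompletion (κ.layer n))) 1,
      u ∉ (W.baseChange (κ.layer n)).kummerLocalConditionAt (p : ℤ) (w.adicCompletion (κ.layer n)))
    {f : IwasawaAlgebra p} (hchar : Module.charIdeal (IwasawaAlgebra p) D.X = Ideal.span {f}) :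
    layerNorm p n f ∈ maximalIdeal (IwasawaAlgebra p) ^ T₀.card :=
  layerNorm_mem_maximalIdeal_pow hX hnf
    (GeneratorCountLayerTransport.pow_card_le_natCard_quotient_layerIdeal_of_tamagawaWitnesses_layer
      n κn hκn D hodd hK hκ inv hperf hsum hcompl hEP T₀ hT₀p hwit) hchar

end Tamagawa

end Summit.BirchSwinnertonDyer.Rank1Residual.X1.GeneratorBoundOrdLayer

end
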